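import Summits.QuantumFields.YangMills.Theorems.LuscherReductionTwistedTraceScalingGaugeAverageBased
import Summits.QuantumFields.YangMills.Theorems.LuscherReductionTwistedTraceScalingTubeBOPackage
import HarnessLib

/-!
# The record weight with a FREE fat radius `ρ(β) ≥ 2δ(β)` — so that slice points of inner orbits stay inside the fat tube — and all its reductions
# (lane A of S-BASE, crux `TwistedTraceScaling` stmt-QuantumFields-20203, C4 INNER; design note `pub/ym-fleet/ym-luscher-20007-p1/COARSE-DESIGN.md` §23.6/§23.8)

`…RecordWeight` fixed the fat tube at link radius `2δ(β)`.  The slice point `U*` of an inner orbit (`…SliceMeets`: `‖ξ‖ ≤ K_L‖w‖`) moves links by `O(K_L δ)`, so the Laplace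
evaluation (N2) wants the fat radius `ρ = M_L·δ` with `M_L` at the successor's disposal.  THIS FILE: `fatTubeRho δ ρ β = nearOne(ρ β) ∩ {orbitDist < δ β}`,
`recordWeightRho δ ρ δg β = 𝟙_{fatTubeRho} · exp(−gaugeCoordSq/δg²)`, and, for `2δ ≤ ρ`:
* ★★★ `innerNoIntruderOneOrbitAt_of_recordWeightRho`: `SoftTubeNoIntruderAt L (recordWeightRho δ ρ δg) → InnerNoIntruderOneOrbitAt L δ` (sandwich admissibility
  `softTubeAdmissible_of_sandwich'`), and with the Born–Oppenheimer package: ★★★ `innerNoIntruderOneOrbitAt_of_recordWeightRho_package`;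
* ★ `recordWeightRho_conj` (global colour rotations), ★★ `gaugeAvg_recordWeightRho_eq_based` (the Faddeev–Popov weight as a BASED average);
* `recordWeight = recordWeightRho δ (2δ)` (`recordWeightRho_two_mul`).
HONEST FRAMING: bookkeeping for a stub of a child of the CONDITIONAL reduction route R2b1; no spectral claim; C4 OPEN; not a gap, not Clay.
-/

set_option autoImplicit false

noncomputable section

open MeasureTheory Real
open scoped BigOperators
open Literature.MathematicalPhysics.QuantumFieldTheory
open Literature.MathematicalPhysics.QuantumLattice

namespace Summit.QuantumFields.YangMills.Theorems.FemtoTransferGap.TwoLattice.ConstTube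

open Summit.QuantumFields.YangMills.Theorems.FemtoTransferGap
open Summit.QuantumFields.YangMills.Theorems.FemtoTransferGap.TwoLattice.Avg

variable (L : ℕ) [NeZero L]

/-! ## §1 The fat tube and the weight with free radius -/

/-- The fat tube with link radius `ρ(β)` and orbit radius `δ(β)`. [folklore] -/
def fatTubeRho (δ ρ : ℝ → ℝ) (β : ℝ) : Set (GaugeConfig 3 L SU2) := nearOne L (ρ β) ∩ {W | orbitDist W < δ β}

/-- It is measurable. [folklore] -/
theorem measurableSet_fatTubeRho (δ ρ : ℝ → ℝ) (β : ℝ) : MeasurableSet (fatTubeRho L δ ρ β) :=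
  (measurableSet_nearOne L _).inter (measurableSet_lt measurable_orbitDist measurable_const)

/-- ★ The record weight with free fat radius: `𝟙_{fatTubeRho δ ρ β} · exp(−gaugeCoordSq/δg(β)²)`. [cite: Luscher1983, §3] -/
def recordWeightRho (δ ρ δg : ℝ → ℝ) (β : ℝ) (U : GaugeConfig 3 L SU2) : ℝ :=
  (fatTubeRho L δ ρ β).indicator (fun _ => (1 : ℝ)) U * Real.exp (-(gaugeCoordSq L U / δg β ^ 2))

/-- At `ρ = 2δ` this is the weight of `…RecordWeight`. [folklore] -/
theorem recordWeightRho_two_mul (δ δg : ℝ → ℝ) : recordWeightRho L δ (fun β => 2 * δ β) δg = recordWeight L δ δg := rfl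

/-- Measurability. [folklore] -/
theorem measurable_recordWeightRho (δ ρ δg : ℝ → ℝ) (β : ℝ) : Measurable (recordWeightRho L δ ρ δg β) := by
  unfold recordWeightRho
  exact (measurable_const.indicator (measurableSet_fatTubeRho L δ ρ β)).mul (measurable_gaussFactor L δg β)

/-- `0 ≤ recordWeightRho ≤ 1`. [folklore] -/
theorem recordWeightRho_mem_Icc (δ ρ δg : ℝ → ℝ) (β : ℝ) (U : GaugeConfig 3 L SU2) : recordWeightRho L δ ρ δg β U ∈ Set.Icc (0 : ℝ) 1 := by
  unfold recordWeightRho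
  have hind0 : 0 ≤ (fatTubeRho L δ ρ β).indicator (fun _ => (1 : ℝ)) U := Set.indicator_nonneg (fun _ _ => zero_le_one) U
  have hind1 : (fatTubeRho L δ ρ β).indicator (fun _ => (1 : ℝ)) U ≤ 1 := Set.indicator_le_self' (fun _ _ => zero_le_one) U
  have hexp0 : 0 ≤ Real.exp (-(gaugeCoordSq L U / δg β ^ 2)) := (Real.exp_pos _).le
  have hexp1 := gaussFactor_le_one L δg β U
  exact ⟨mul_nonneg hind0 hexp0, by nlinarith⟩

/-! ## §2 ★★★ The reductions: C4-CORE from the soft tube statement / the BO package for `recordWeightRho` -/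

/-- ★★ Sandwich admissibility for any fat radius `ρ ≥ 2δ > 0`. [folklore] -/
theorem softTubeAdmissible_recordWeightRho {δ ρ δg : ℝ → ℝ} (hδ : ∀ β, 0 < δ β) (hρ : ∀ β, 2 * δ β ≤ ρ β) :
    SoftTubeAdmissible L δ (recordWeightRho L δ ρ δg) := by
  have h := softTubeAdmissible_of_sandwich' L (δ := δ) (ρ := ρ) (T := fatTubeRho L δ ρ) (measurableSet_fatTubeRho L δ ρ)
    (fun β => by linarith [hδ β, hρ β]) (fun β => ⟨by linarith [hρ β], subset_rfl, Set.inter_subset_right⟩)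
    (w := fun β U => Real.exp (-(gaugeCoordSq L U / δg β ^ 2))) (measurable_gaussFactor L δg)
    (m := fun β => Real.exp (-((Fintype.card (Edge 3 L) : ℝ) / δg β ^ 2))) (fun β => Real.exp_pos _) (gaussFactor_ge L δg) (gaussFactor_le_one L δg)
  exact h

/-- ★★★ **C4-CORE from the soft tube statement for the weight with free fat radius.** [cite: Luscher1983, §3] -/
theorem innerNoIntruderOneOrbitAt_of_recordWeightRho {δ ρ δg : ℝ → ℝ} (hδ : ∀ β, 0 < δ β) (hρ : ∀ β, 2 * δ β ≤ ρ β)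
    (h : SoftTubeNoIntruderAt L (recordWeightRho L δ ρ δg)) : InnerNoIntruderOneOrbitAt L δ :=
  innerNoIntruderOneOrbitAt_of_softTube (softTubeAdmissible_recordWeightRho L hδ hρ) h

/-- ★★★ **C4-CORE from the Born–Oppenheimer package for the weight with free fat radius.** [cite: Luscher1983, §3] -/
theorem innerNoIntruderOneOrbitAt_of_recordWeightRho_package {δ ρ δg : ℝ → ℝ} (hδ : ∀ β, 0 < δ β) (hρ : ∀ β, 2 * δ β ≤ ρ β)
    (hP : SoftTubeBOPackageAt L (recordWeightRho L δ ρ δg)) : InnerNoIntruderOneOrbitAt L δ :=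
  innerNoIntruderOneOrbitAt_of_softTubePackage (softTubeAdmissible_recordWeightRho L hδ hρ) hP

/-- ★★★ The instance of record: core `β^{-s}`, fat radius `M·β^{-s}` (`M ≥ 2`), gauge width `β^{-t}`. [cite: Luscher1983, §3] -/
theorem innerNoIntruderOneOrbitAt_pow_of_recordWeightRho_package (s t M : ℝ) (hM : 2 ≤ M)
    (hP : SoftTubeBOPackageAt L (recordWeightRho L (powScale s) (fun β => M * powScale s β) (powScale t))) : InnerNoIntruderOneOrbitAt L (powScale s) :=
  innerNoIntruderOneOrbitAt_of_recordWeightRho_package L (fun β => powScale_pos s β)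
    (fun β => mul_le_mul_of_nonneg_right hM (powScale_pos s β).le) hP

/-! ## §3 Invariance under global colour rotations and the based average -/

/-- The fat tube is invariant under global colour rotations. [folklore] -/
theorem conj_mem_fatTubeRho_iff (g : SU2) (δ ρ : ℝ → ℝ) (β : ℝ) (U : GaugeConfig 3 L SU2) :
    gaugeTransform (fun _ => g) U ∈ fatTubeRho L δ ρ β ↔ U ∈ fatTubeRho L δ ρ β := by
  have hnear : ∀ r : ℝ, gaugeTransform (fun _ => g) U ∈ nearOne L r ↔ U ∈ nearOne L r := fun r => by
    have hlink : ∀ e : Edge 3 L, frobNorm (((gaugeTransform (fun _ => g) U e : SU2) : Matrix (Fin 2) (Fin 2) ℂ) - 1) =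
        frobNorm (((U e : SU2) : Matrix (Fin 2) (Fin 2) ℂ) - 1) := fun e => by
      have h1 : gaugeTransform (fun _ : Site 3 L => g) (1 : GaugeConfig 3 L SU2) e = 1 := by
        rw [gaugeTransform_const_apply', Pi.one_apply, mul_one, mul_inv_cancel]
      have h := frobNorm_gaugeTransform_sub (fun _ => g) U 1 e
      rwa [h1, Pi.one_apply, OneMemClass.coe_one] at h
    simp only [nearOne, Set.mem_setOf_eq, hlink]
  simp only [fatTubeRho, Set.mem_inter_iff, hnear, Set.mem_setOf_eq, orbitDist_gaugeTransform]

/-- ★ `recordWeightRho(gUg⁻¹) = recordWeightRho(U)`. [folklore] -/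
theorem recordWeightRho_conj (g : SU2) (δ ρ δg : ℝ → ℝ) (β : ℝ) (U : GaugeConfig 3 L SU2) :
    recordWeightRho L δ ρ δg β (gaugeTransform (fun _ => g) U) = recordWeightRho L δ ρ δg β U := by
  unfold recordWeightRho
  rw [gaugeCoordSq_conj]
  congr 1
  by_cases hU : U ∈ fatTubeRho L δ ρ β
  · rw [Set.indicator_of_mem hU, Set.indicator_of_mem ((conj_mem_fatTubeRho_iff L g δ ρ β U).mpr hU)]
  · rw [Set.indicator_of_notMem hU, Set.indicator_of_notMem (fun h => hU ((conj_mem_fatTubeRho_iff L g δ ρ β U).mp h))]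

/-- ★★ **The Faddeev–Popov weight with free fat radius is a based average.** [folklore] -/
theorem gaugeAvg_recordWeightRho_eq_based (δ ρ δg : ℝ → ℝ) (β : ℝ) (U : GaugeConfig 3 L SU2) :
    gaugeAvg (recordWeightRho L δ ρ δg β) U = ∫ h, recordWeightRho L δ ρ δg β (gaugeTransform (basedExt L h) U) ∂basedMeasure L := by
  unfold gaugeAvg
  refine integral_gaugeMeasure_eq_based L (F := fun g => recordWeightRho L δ ρ δg β (gaugeTransform g U))
    (measurable_comp_gaugeTransform_left (measurable_recordWeightRho L δ ρ δg β) U) (C := 1) (fun g => ?_) (fun c g => ?_)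
  · obtain ⟨h0, h1⟩ := recordWeightRho_mem_Icc L δ ρ δg β (gaugeTransform g U)
    rw [abs_of_nonneg h0]; exact h1
  · have h : gaugeTransform (fun x => c * g x) U = gaugeTransform (fun _ => c) (gaugeTransform g U) := by
      funext e; simp [gaugeTransform, mul_assoc]
    rw [h, recordWeightRho_conj]

/-- The Faddeev–Popov weight is an ORBIT function: `gaugeAvg χ (U^{g'}) = gaugeAvg χ U`. [folklore] -/
theorem gaugeAvg_recordWeightRho_gaugeTransform (δ ρ δg : ℝ → ℝ) (β : ℝ) (g' : Site 3 L → SU2) (U : GaugeConfig 3 L SU2) :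
    gaugeAvg (recordWeightRho L δ ρ δg β) (gaugeTransform g' U) = gaugeAvg (recordWeightRho L δ ρ δg β) U :=
  gaugeAvg_gaugeTransform _ g' U

end Summit.QuantumFields.YangMills.Theorems.FemtoTransferGap.TwoLattice.ConstTube

end
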